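import Literature.Geometry.Symplectic.NearSymplecticModelChartsReduction
import Mathlib.Analysis.Calculus.MeanValue
import HarnessLib

/-!
# Zeros near a non-degenerate axis of zeros lie on the axis (uniformly along the axis)

Topic `Geometry/Symplectic`; namespace `Literature.Geometry.Symplectic`.  Theorems only; no named
fact, no `sorry`.  The quantitative implicit-function step behind "the zero set of a near-symplectic
form is, near one of its zero circles, exactly that circle" (Perutz 2006, Lemma 1.2; Honda 2004,
§2), in the tube coordinates `q = (θ, x) ∈ ℝ × ℝ³ = ℝ⁴` of `HondaUntwistedModel.lean`
(`hondaAxis = {x = 0}`, `hondaTube r = {|x| < r}`):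

Let `F : ℝ⁴ → V` be `C¹` on `hondaTube r`, `2π`-periodic in `θ`, vanishing on the axis, and with
`DF(θ, 0)` injective on the normal directions `{w | w 0 = 0}` at every axis point.  Then there is
`0 < r' ≤ r` such that every zero of `F` in `hondaTube r'` lies on the axis
(`exists_radius_forall_eq_zero_mem_hondaAxis`).

Proof: at an axis point `p`, injectivity on the normal slice gives `c |w| ≤ |DF(p) w|`
(`exists_bound_of_injective_on_slice`, compactness of the unit sphere of the slice); continuity of
`DF` and the mean value inequality on a ball about `p` give `|DF(p)(q - a)| ≤ (c/2)|q - a|` for a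
zero `q` with axis foot `a = (q 0, 0)`, whence `q = a` (`forall_eq_zero_mem_hondaAxis_near`);
compactness of `θ ∈ [0, 2π]` and periodicity make the radius uniform.

## References

* T. Perutz, *Zero-sets of near-symplectic forms*, J. Symplectic Geom. 4 (2006), Lemma 1.2. [Perutz2006]
* K. Honda, *Local properties of self-dual harmonic 2-forms on a 4-manifold*,
  J. reine angew. Math. 577 (2004), §2. [Honda2004LocalSD]
-/

noncomputable section

open Set Metric Filter Topology Real

namespace Literature.Geometry.Symplectic

/-! ### Coordinates: the axis foot of a point and the normal slice -/

/-- The foot `(q 0, 0, 0, 0)` of `q` on the axis lies on the axis. [folklore] -/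
theorem single_zero_mem_hondaAxis (θ : ℝ) :
    (EuclideanSpace.single (0 : Fin 4) θ : EuclideanSpace ℝ (Fin 4)) ∈ hondaAxis := by
  simp [mem_hondaAxis]

/-- `‖v‖² = Σ (v i)²` on `ℝ⁴`, solved for the normal part: if `v 0 = 0` then
`‖v‖² = (v 1)² + (v 2)² + (v 3)²`. [folklore] -/
theorem norm_sq_of_apply_zero_eq_zero {v : EuclideanSpace ℝ (Fin 4)} (h : v 0 = 0) :
    ‖v‖ ^ 2 = v 1 ^ 2 + v 2 ^ 2 + v 3 ^ 2 := by
  have := sum_sq_four_eq_norm_sq v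
  rw [h] at this
  linarith

/-- The difference of `q` and its axis foot is normal (`0`-th coordinate zero). [folklore] -/
theorem sub_single_apply_zero (q : EuclideanSpace ℝ (Fin 4)) :
    (q - EuclideanSpace.single (0 : Fin 4) (q 0)) 0 = 0 := by
  simp

/-- The distance from `q` to its axis foot is `|x|`: `‖q - (q 0, 0)‖² = (q 1)² + (q 2)² + (q 3)²`.
[folklore] -/
theorem norm_sub_single_sq (q : EuclideanSpace ℝ (Fin 4)) :
    ‖q - EuclideanSpace.single (0 : Fin 4) (q 0)‖ ^ 2 = q 1 ^ 2 + q 2 ^ 2 + q 3 ^ 2 := by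
  rw [norm_sq_of_apply_zero_eq_zero (sub_single_apply_zero q)]
  simp

/-- In `hondaTube r'`, the distance to the axis foot is `< r'`. [folklore] -/
theorem norm_sub_single_lt_of_mem_hondaTube {r' : ℝ} (hr' : 0 < r') {q : EuclideanSpace ℝ (Fin 4)}
    (hq : q ∈ hondaTube r') : ‖q - EuclideanSpace.single (0 : Fin 4) (q 0)‖ < r' := by
  rw [mem_hondaTube] at hq
  have h2 := norm_sub_single_sq q
  exact lt_of_pow_lt_pow_left₀ 2 hr'.le (by rw [h2]; exact hq)

/-- A point at distance `0` from its axis foot is on the axis. [folklore] -/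
theorem mem_hondaAxis_of_norm_sub_single_le_zero {q : EuclideanSpace ℝ (Fin 4)}
    (h : ‖q - EuclideanSpace.single (0 : Fin 4) (q 0)‖ ≤ 0) : q ∈ hondaAxis := by
  have h0 : ‖q - EuclideanSpace.single (0 : Fin 4) (q 0)‖ = 0 := le_antisymm h (norm_nonneg _)
  have h2 := norm_sub_single_sq q
  rw [h0] at h2
  rw [mem_hondaAxis]
  refine ⟨?_, ?_, ?_⟩ <;> nlinarith [sq_nonneg (q 1), sq_nonneg (q 2), sq_nonneg (q 3)]

/-- Axis feet of nearby parameters are nearby: `‖(a, 0) - (b, 0)‖ = |a - b|`. [folklore] -/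
theorem norm_single_sub_single (a b : ℝ) :
    ‖(EuclideanSpace.single (0 : Fin 4) a : EuclideanSpace ℝ (Fin 4)) -
      EuclideanSpace.single (0 : Fin 4) b‖ = |a - b| := by
  rw [← dist_eq_norm, PiLp.dist_single_same, Real.dist_eq]

/-! ### Injectivity on the normal slice gives a lower bound -/

/-- **A linear map injective on the normal slice `{w | w 0 = 0}` is bounded below there**:
`c ‖w‖ ≤ ‖L w‖` (minimum of `‖L ·‖` on the compact unit sphere of the slice). [folklore] -/
theorem exists_bound_of_injective_on_slice {V : Type*} [NormedAddCommGroup V] [NormedSpace ℝ V]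
    (L : EuclideanSpace ℝ (Fin 4) →L[ℝ] V)
    (hL : ∀ w : EuclideanSpace ℝ (Fin 4), w 0 = 0 → L w = 0 → w = 0) :
    ∃ c : ℝ, 0 < c ∧ ∀ w : EuclideanSpace ℝ (Fin 4), w 0 = 0 → c * ‖w‖ ≤ ‖L w‖ := by
  set S : Set (EuclideanSpace ℝ (Fin 4)) := {w | w 0 = 0} ∩ sphere 0 1 with hS
  have hSc : IsCompact S := by
    refine (isCompact_sphere (0 : EuclideanSpace ℝ (Fin 4)) 1).inter_left ?_
    exact isClosed_eq (EuclideanSpace.proj (𝕜 := ℝ) (0 : Fin 4)).continuous continuous_const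
  have he : (EuclideanSpace.single (1 : Fin 4) (1 : ℝ) : EuclideanSpace ℝ (Fin 4)) ∈ S := by
    refine ⟨by simp, ?_⟩
    rw [mem_sphere_zero_iff_norm, PiLp.norm_single, norm_one]
  have hf : Continuous fun w : EuclideanSpace ℝ (Fin 4) ↦ ‖L w‖ := L.continuous.norm
  obtain ⟨w₀, hw₀, hmin⟩ := hSc.exists_isMinOn ⟨_, he⟩ hf.continuousOn
  have hw₀n : ‖w₀‖ = 1 := mem_sphere_zero_iff_norm.1 hw₀.2
  have hc : 0 < ‖L w₀‖ := by
    refine norm_pos_iff.2 fun h ↦ ?_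
    have := hL w₀ hw₀.1 h
    rw [this, norm_zero] at hw₀n
    exact zero_ne_one hw₀n
  refine ⟨‖L w₀‖, hc, fun w hw ↦ ?_⟩
  by_cases hw0 : w = 0
  · simp [hw0]
  have hwn : 0 < ‖w‖ := norm_pos_iff.2 hw0
  have hu : ‖w‖⁻¹ • w ∈ S := by
    refine ⟨by simp [hw], ?_⟩
    rw [mem_sphere_zero_iff_norm, norm_smul, norm_inv, norm_norm, inv_mul_cancel₀ hwn.ne']
  have h1 : ‖L w₀‖ ≤ ‖L (‖w‖⁻¹ • w)‖ := hmin hu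
  rw [map_smul, norm_smul, norm_inv, norm_norm] at h1
  calc ‖L w₀‖ * ‖w‖ ≤ ‖w‖⁻¹ * ‖L w‖ * ‖w‖ := mul_le_mul_of_nonneg_right h1 hwn.le
    _ = ‖L w‖ := by field_simp

/-! ### The local statement near an axis point -/

/-- **Zeros near a non-degenerate axis point lie on the axis.**  Let `F` be `C¹` on `hondaTube r`,
zero on the axis, with `DF(p)` injective on the normal slice at the axis point `p = (θ, 0)`.  Then
for `q` close to `p`, `F q = 0 ⇒ q ∈ hondaAxis` (mean value inequality for `F - DF(p)` between `q`
and its axis foot). [cite: Perutz2006, Lemma 1.2] -/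
theorem forall_eq_zero_mem_hondaAxis_near {V : Type*} [NormedAddCommGroup V] [NormedSpace ℝ V]
    {F : EuclideanSpace ℝ (Fin 4) → V} {r : ℝ} (hr : 0 < r) (hF : ContDiffOn ℝ 1 F (hondaTube r))
    (h0 : ∀ q ∈ hondaAxis, F q = 0) (θ : ℝ)
    (hinj : ∀ w : EuclideanSpace ℝ (Fin 4), w 0 = 0 →
      fderiv ℝ F (EuclideanSpace.single (0 : Fin 4) θ) w = 0 → w = 0) :
    ∃ δ : ℝ, 0 < δ ∧ ∀ q : EuclideanSpace ℝ (Fin 4),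
      ‖q - EuclideanSpace.single (0 : Fin 4) θ‖ < δ → F q = 0 → q ∈ hondaAxis := by
  set p : EuclideanSpace ℝ (Fin 4) := EuclideanSpace.single (0 : Fin 4) θ with hp
  have hpA : p ∈ hondaAxis := single_zero_mem_hondaAxis θ
  have hpT : p ∈ hondaTube r := hondaAxis_subset_hondaTube hr hpA
  set L := fderiv ℝ F p with hLdef
  obtain ⟨c, hc, hcL⟩ := exists_bound_of_injective_on_slice L hinj
  -- continuity of `DF` at `p` and a ball inside the tube
  have hDc : ContinuousOn (fderiv ℝ F) (hondaTube r) :=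
    hF.continuousOn_fderiv_of_isOpen (isOpen_hondaTube r) le_rfl
  have hcont : ContinuousAt (fderiv ℝ F) p :=
    hDc.continuousAt ((isOpen_hondaTube r).mem_nhds hpT)
  obtain ⟨δ₁, hδ₁, hδ₁F⟩ := Metric.continuousAt_iff.1 hcont (c / 2) (half_pos hc)
  obtain ⟨δ₂, hδ₂, hball⟩ := Metric.isOpen_iff.1 (isOpen_hondaTube r) p hpT
  set δ := min δ₁ δ₂ with hδ
  have hδpos : 0 < δ := lt_min hδ₁ hδ₂
  have hballT : ball p δ ⊆ hondaTube r := (ball_subset_ball (min_le_right _ _)).trans hball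
  -- derivative of `F - L` within the ball, bounded by `c / 2`
  have hderiv : ∀ z ∈ ball p δ, HasFDerivWithinAt (fun z ↦ F z - L z) (fderiv ℝ F z - L)
      (ball p δ) z := by
    intro z hz
    have hzT : z ∈ hondaTube r := hballT hz
    have hd : HasFDerivAt F (fderiv ℝ F z) z :=
      (((hF.differentiableOn one_ne_zero) z hzT).differentiableAt
        ((isOpen_hondaTube r).mem_nhds hzT)).hasFDerivAt
    exact (hd.sub L.hasFDerivAt).hasFDerivWithinAt
  have hbound : ∀ z ∈ ball p δ, ‖(fderiv ℝ F z - L) - 0‖ ≤ c / 2 := by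
    intro z hz
    rw [sub_zero, ← dist_eq_norm]
    exact (hδ₁F (lt_of_lt_of_le (mem_ball.1 hz) (min_le_left _ _))).le
  refine ⟨δ, hδpos, fun q hq hFq ↦ ?_⟩
  set a : EuclideanSpace ℝ (Fin 4) := EuclideanSpace.single (0 : Fin 4) (q 0) with ha
  have haA : a ∈ hondaAxis := single_zero_mem_hondaAxis (q 0)
  have hqball : q ∈ ball p δ := by rwa [mem_ball, dist_eq_norm]
  have haball : a ∈ ball p δ := by
    rw [mem_ball, dist_eq_norm, ha, hp, norm_single_sub_single]
    -- `|(q - p) 0| ≤ ‖q - p‖` (this is `Literature.Topology.FourManifolds.BraidedSheetCoords.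
    -- abs_apply_zero_le_norm`, not imported here to keep the import graph light)
    have h1 : |q 0 - θ| ≤ ‖q - p‖ := by
      have h3 : (q - p) 0 = q 0 - θ := by simp [hp]
      have h2 := sum_sq_four_eq_norm_sq (q - p)
      rw [h3] at h2
      refine abs_le_of_sq_le_sq' ?_ (norm_nonneg _) |>.elim (fun h4 h5 ↦ abs_le.2 ⟨h4, h5⟩)
      nlinarith [sq_nonneg ((q - p) 1), sq_nonneg ((q - p) 2), sq_nonneg ((q - p) 3)]
    exact lt_of_le_of_lt h1 hq
  have hMVT := Convex.norm_image_sub_le_of_norm_hasFDerivWithin_le' hderiv hbound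
    (convex_ball p δ) haball hqball
  -- `F q = F a = 0`, so `‖L (q - a)‖ ≤ (c/2) ‖q - a‖`
  have hMVT' : ‖(F q - L q) - (F a - L a) -
      (0 : EuclideanSpace ℝ (Fin 4) →L[ℝ] V) (q - a)‖ ≤ c / 2 * ‖q - a‖ := hMVT
  have h1 : (F q - L q) - (F a - L a) - (0 : EuclideanSpace ℝ (Fin 4) →L[ℝ] V) (q - a) =
      -(L (q - a)) := by
    rw [hFq, h0 a haA, map_sub]; simp; abel
  rw [h1, norm_neg] at hMVT'
  -- while `c ‖q - a‖ ≤ ‖L (q - a)‖`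
  have hlow := hcL (q - a) (by rw [ha]; exact sub_single_apply_zero q)
  have hle : ‖q - a‖ ≤ 0 := by nlinarith [norm_nonneg (q - a)]
  exact mem_hondaAxis_of_norm_sub_single_le_zero (by rw [ha] at hle; exact hle)

/-! ### Periodicity along the axis -/

/-- Iterating the period: `F (q + 2πk e₀) = F q` for all integers `k`. [folklore] -/
theorem apply_add_int_mul_two_pi_smul {V : Type*} {F : EuclideanSpace ℝ (Fin 4) → V}
    (hper : ∀ q, F (q + (2 * π) • EuclideanSpace.single (0 : Fin 4) (1 : ℝ)) = F q)
    (q : EuclideanSpace ℝ (Fin 4)) (k : ℤ) :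
    F (q + ((k : ℝ) * (2 * π)) • EuclideanSpace.single (0 : Fin 4) (1 : ℝ)) = F q := by
  induction k using Int.induction_on generalizing q with
  | zero => simp
  | succ n ih =>
    have h1 : q + ((((n : ℤ) + 1 : ℤ) : ℝ) * (2 * π)) • EuclideanSpace.single (0 : Fin 4) (1 : ℝ) =
        (q + ((((n : ℤ) : ℤ) : ℝ) * (2 * π)) • EuclideanSpace.single (0 : Fin 4) (1 : ℝ)) +
          (2 * π) • EuclideanSpace.single (0 : Fin 4) (1 : ℝ) := by
      rw [add_assoc, ← add_smul]; push_cast; ring_nf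
    rw [h1, hper, ih]
  | pred n ih =>
    have h1 := hper
      (q + ((((-(n : ℤ) - 1 : ℤ) : ℝ)) * (2 * π)) • EuclideanSpace.single (0 : Fin 4) (1 : ℝ))
    have h2 : q + ((((-(n : ℤ) - 1 : ℤ) : ℝ)) * (2 * π)) • EuclideanSpace.single (0 : Fin 4) (1 : ℝ) +
        (2 * π) • EuclideanSpace.single (0 : Fin 4) (1 : ℝ) =
        q + ((((-(n : ℤ) : ℤ) : ℝ)) * (2 * π)) • EuclideanSpace.single (0 : Fin 4) (1 : ℝ) := by
      rw [add_assoc, ← add_smul]; push_cast; ring_nf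
    rw [h2, ih] at h1
    exact h1.symm

/-! ### The uniform statement -/

/-- **Zeros near a non-degenerate, periodic axis of zeros lie on the axis, uniformly.**  Let
`F : ℝ⁴ → V` be `C¹` on `hondaTube r` (`0 < r`), `2π`-periodic in `θ = q 0`, vanishing on
`hondaAxis`, and such that at every axis point `DF` is injective on the normal slice `{w | w 0 = 0}`.
Then there is `0 < r' ≤ r` such that every zero of `F` in `hondaTube r'` lies on the axis.
[cite: Perutz2006, Lemma 1.2] -/
theorem exists_radius_forall_eq_zero_mem_hondaAxis {V : Type*} [NormedAddCommGroup V]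
    [NormedSpace ℝ V] {F : EuclideanSpace ℝ (Fin 4) → V} {r : ℝ} (hr : 0 < r)
    (hF : ContDiffOn ℝ 1 F (hondaTube r))
    (hper : ∀ q, F (q + (2 * π) • EuclideanSpace.single (0 : Fin 4) (1 : ℝ)) = F q)
    (h0 : ∀ q ∈ hondaAxis, F q = 0)
    (hinj : ∀ q ∈ hondaAxis, ∀ w : EuclideanSpace ℝ (Fin 4), w 0 = 0 →
      fderiv ℝ F q w = 0 → w = 0) :
    ∃ r' : ℝ, 0 < r' ∧ r' ≤ r ∧ ∀ q ∈ hondaTube r', F q = 0 → q ∈ hondaAxis := by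
  -- local radii along the axis
  have hloc : ∀ θ : ℝ, ∃ δ : ℝ, 0 < δ ∧ ∀ q : EuclideanSpace ℝ (Fin 4),
      ‖q - EuclideanSpace.single (0 : Fin 4) θ‖ < δ → F q = 0 → q ∈ hondaAxis := fun θ ↦
    forall_eq_zero_mem_hondaAxis_near hr hF h0 θ (hinj _ (single_zero_mem_hondaAxis θ))
  choose δ hδ hδP using hloc
  -- a finite subcover of `[0, 2π]`
  obtain ⟨T, -, hcover⟩ := (isCompact_Icc : IsCompact (Icc (0 : ℝ) (2 * π))).elim_nhds_subcover
    (fun θ ↦ ball θ (δ θ / 2)) (fun θ _ ↦ ball_mem_nhds θ (half_pos (hδ θ)))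
  have h0mem : (0 : ℝ) ∈ Icc (0 : ℝ) (2 * π) := ⟨le_rfl, by positivity⟩
  have hTne : T.Nonempty := by
    obtain ⟨θ, hθ, -⟩ := mem_iUnion₂.1 (hcover h0mem)
    exact ⟨θ, hθ⟩
  set r' : ℝ := min r (T.inf' hTne fun θ ↦ δ θ / 2) with hr'
  have hr'pos : 0 < r' :=
    lt_min hr ((Finset.lt_inf'_iff hTne).2 fun θ _ ↦ half_pos (hδ θ))
  have hr'le : ∀ θ ∈ T, r' ≤ δ θ / 2 := fun θ hθ ↦
    (min_le_right _ _).trans (Finset.inf'_le _ hθ)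
  refine ⟨r', hr'pos, min_le_left _ _, fun q hq hFq ↦ ?_⟩
  -- reduce `q 0` into `[0, 2π)` by an integer shift along the axis
  set k : ℤ := toIcoDiv two_pi_pos 0 (q 0) with hk
  set q' : EuclideanSpace ℝ (Fin 4) :=
    q + (((-k : ℤ) : ℝ) * (2 * π)) • EuclideanSpace.single (0 : Fin 4) (1 : ℝ) with hq'
  have hq'0 : q' 0 = toIcoMod two_pi_pos 0 (q 0) := by
    rw [toIcoMod, hq', ← hk]
    simp [zsmul_eq_mul]
    ring
  have hq'I : q' 0 ∈ Icc (0 : ℝ) (2 * π) := by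
    have h := toIcoMod_mem_Ico two_pi_pos 0 (q 0)
    rw [zero_add] at h
    rw [hq'0]
    exact ⟨h.1, h.2.le⟩
  have hq'T : q' ∈ hondaTube r' := add_smul_single_mem_hondaTube hq _
  have hFq' : F q' = 0 := by rw [hq', apply_add_int_mul_two_pi_smul hper, hFq]
  -- `q'` is close to a centre of the cover
  obtain ⟨θ, hθT, hθ⟩ := mem_iUnion₂.1 (hcover hq'I)
  have hclose : ‖q' - EuclideanSpace.single (0 : Fin 4) θ‖ < δ θ := by
    have h1 := norm_sub_single_lt_of_mem_hondaTube hr'pos hq'T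
    have h2 : ‖(EuclideanSpace.single (0 : Fin 4) (q' 0) : EuclideanSpace ℝ (Fin 4)) -
        EuclideanSpace.single (0 : Fin 4) θ‖ < δ θ / 2 := by
      rw [norm_single_sub_single, ← Real.dist_eq]; exact mem_ball.1 hθ
    calc ‖q' - EuclideanSpace.single (0 : Fin 4) θ‖
        ≤ ‖q' - EuclideanSpace.single (0 : Fin 4) (q' 0)‖ +
          ‖(EuclideanSpace.single (0 : Fin 4) (q' 0) : EuclideanSpace ℝ (Fin 4)) -
            EuclideanSpace.single (0 : Fin 4) θ‖ := norm_sub_le_norm_sub_add_norm_sub _ _ _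
      _ < δ θ / 2 + δ θ / 2 := add_lt_add (lt_of_lt_of_le h1 (hr'le θ hθT)) h2
      _ = δ θ := by ring
  have hq'A : q' ∈ hondaAxis := hδP θ q' hclose hFq'
  rwa [hq', mem_hondaAxis_add_smul_single_iff] at hq'A

end Literature.Geometry.Symplectic

end
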